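import Summits.Ventures.LatticeQCDFlow.Scaling.ParallelTemperingHalfSweep

/-!
HONEST FRAMING: exact (Metropolis-corrected) sampling algorithms for lattice gauge theory; figures
of merit are autocorrelation/cost numbers at stated couplings and volumes; no continuum-physics
claim.

# ParallelTemperingHalfSweepLadder — THE TWO-SIDED LADDER LAW OF PTBC PER HALF-SWEEP,
# `6e^{−(Δ√(2M)+MΔ²)} ≤ (K+1)(K+2)(1 − ρ_τ(1)) ≤ 6e^{−mΔ²/4}`, ATTAINED WITH `K* = ⌈(b−a)√(2M)⌉` GAPS
# (lean-2 GEN-15, ours)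

Venture-side (OURS).  Cell `lqcd-flow` (pub-lqcd), unit `pub-lqcd-lean-2-g15`, 2026-08-24.  Companion of
`Scaling/ParallelTemperingHalfSweep` (the random-parity half-sweep `H` of swap attempts; exact tag law
`ρ_τ(1) = 1 − 3ā_K/(K(K+2))` for `Mk ∘ₖ H`).  On the uniform ladder `β_k = a + kΔ`, `Δ = (b−a)/K`, under a variance
floor and ceiling `m ≤ Var_{μ_u}(X) ≤ M` on `[a,b]`, GEN-11's swap-acceptance bounds
(`Scaling/SwapAcceptanceLadder`: `swapAcc ≤ e^{−mδ²/4}`, `swapAcc ≥ e^{−(δ√(2M)+Mδ²)}`) turn the identity into the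
two-sided law below — the PTBC counterpart, per half-sweep, of GEN-14's simulated-tempering ladder law
(`Scaling/SimulatedTemperingExactLevelLaw` §3, `Scaling/SimulatedTemperingExactLadderLaws` §1).

## What is proved (`X` bounded measurable, `μ` a probability measure, `Mk` any tag-preserving Markov update)

* `ptHalfScan_one_sub_lagOneAutocorr_le` (floor only: `1 − ρ_τ(1) ≤ 6e^{−mΔ²/4}/((K+1)(K+2))`);
  **`ptHalfScan_one_sub_lagOneAutocorr_twoSided`** (`K ≥ 1`, `a < b`):
  `6e^{−(Δ√(2M)+MΔ²)}/((K+1)(K+2)) ≤ 1 − ρ_τ(1) ≤ 6e^{−mΔ²/4}/((K+1)(K+2))` per half-sweep.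
* **`ptHalfScan_one_sub_lagOneAutocorr_ge_optimalLadder`** (`0 < M`): with `K* = ⌈(b−a)√(2M)⌉₊` gaps
  `1 − ρ_τ(1) ≥ 6e^{−2}/(((b−a)√(2M)+2)((b−a)√(2M)+3))` — the ladder-size-free rate `Θ(1/(M(b−a)²))` per
  half-sweep is attained; `ptHalfScan_level_lagOneAutocorr_lt_one` (`ρ_τ(1) < 1`, every ladder).

Reading (no numerics implied): per half-sweep of swap proposals the tagged replica's level decorrelates at lag one
exactly like the coupling index of simulated tempering; with `K ≍ (b−a)√M` replicas at rate `Θ(1/(M(b−a)²))` and no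
faster, with fewer replicas exponentially slower.  NOT CLAIMED: non-uniform ladders; higher lags; anything measured.
Literature grade (cell rule): TEXTBOOK ALGORITHM + KNOWN MECHANISM, NEW TYPING; nothing cited as a fact; no new bib
keys.
-/

noncomputable section

open MeasureTheory ProbabilityTheory Set Filter Finset
open Summit.Ventures.LatticeQCDFlow.Exactness Summit.Ventures.LatticeQCDFlow.Scoring
open scoped ENNReal

namespace Summit.Ventures.LatticeQCDFlow.Scaling

/-! ## §4 The two-sided ladder law per half-sweep -/

section Ladder

variable {Ω : Type*} [MeasurableSpace Ω] {X : Ω → ℝ} {μ : Measure Ω} [IsProbabilityMeasure μ] {K : ℕ}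

/-- **THE CEILING ON `1 − ρ_τ(1)` PER HALF-SWEEP FROM A VARIANCE FLOOR ALONE**: uniform ladder `β_k = a + kΔ`,
`Δ = (b−a)/K`, `a ≤ b`, `K ≥ 1`, `m ≤ Var_{μ_u}(X)` on `[a,b]`, `Mk` any tag-preserving Markov replica update:
`1 − ρ_τ(1) ≤ 6·e^{−mΔ²/4}/((K+1)(K+2))` for `Mk ∘ₖ H`. [ours] -/
theorem ptHalfScan_one_sub_lagOneAutocorr_le (hXm : Measurable X) (hXb : ∃ C, ∀ x, |X x| ≤ C) {a b m : ℝ}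
    (hab : a ≤ b) (hm : ∀ u ∈ Icc a b, m ≤ variance X (μ.tilted fun x => u * X x)) (hK : 1 ≤ K)
    (Mk : Kernel (Fin (K + 1) × (Fin (K + 1) → Ω)) (Fin (K + 1) × (Fin (K + 1) → Ω))) [IsMarkovKernel Mk]
    (hMk : ∀ y, Mk y {y' | ((y'.1 : Fin (K + 1)) : ℕ) ≠ ((y.1 : Fin (K + 1)) : ℕ)} = 0) :
    1 - (autocov (Mk ∘ₖ ptHalfSweep hXm (fun k => a + k * ((b - a) / K)) K)
          (ptTaggedTarget X μ (fun k => a + k * ((b - a) / K)) K)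
          (fun z => (((z.1 : Fin (K + 1)) : ℕ) : ℝ)) 1 - ((K : ℝ) / 2) ^ 2) / (K * (K + 2) / 12) ≤
      6 * Real.exp (-(m * (b - a) ^ 2 / (4 * K ^ 2))) / ((K + 1) * (K + 2)) := by
  rw [ptHalfScan_level_lagOneAutocorr_eq (β := fun k => a + k * ((b - a) / K)) hXm hXb hK Mk hMk]
  have hKr : (1 : ℝ) ≤ K := by exact_mod_cast hK
  have hK0 : (0 : ℝ) < K := by linarith
  set S : ℝ := ∑ j : Fin K, swapAcc X μ (a + (j : ℕ) * ((b - a) / K)) (a + (((j : ℕ) + 1 : ℕ) : ℝ) * ((b - a) / K))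
    with hS_def
  have hup : 2 / (K + 1) * S ≤ 2 * K / (K + 1) * Real.exp (-(m * (b - a) ^ 2 / (4 * K ^ 2))) :=
    pt_moveRate_le_ladder (μ := μ) hXm hXb hab hK hm
  have hK1 : (0 : ℝ) < K + 1 := by linarith
  have e : 1 - (1 - 3 * (2 / (K + 1) * S) / (K * (K + 2))) = 3 * (2 / (K + 1) * S) / (K * (K + 2)) := by
    ring
  rw [e]
  calc 3 * (2 / (K + 1) * S) / (K * (K + 2))
      ≤ 3 * (2 * K / (K + 1) * Real.exp (-(m * (b - a) ^ 2 / (4 * K ^ 2)))) / (K * (K + 2)) := by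
        gcongr
    _ = 6 * Real.exp (-(m * (b - a) ^ 2 / (4 * K ^ 2))) / ((K + 1) * (K + 2)) := by
        field_simp
        norm_num

/-- **THE TWO-SIDED LADDER LAW PER HALF-SWEEP.**  Uniform ladder `β_k = a + kΔ`, `Δ = (b−a)/K`, `a < b`, `K ≥ 1`,
variance floor and ceiling `m ≤ Var_{μ_u}(X) ≤ M` on `[a, b]`, `Mk` any tag-preserving Markov replica update.  Then
the PTBC sampler `Mk ∘ₖ H` satisfies
`6·e^{−(Δ√(2M) + MΔ²)}/((K+1)(K+2)) ≤ 1 − ρ_τ(1) ≤ 6·e^{−mΔ²/4}/((K+1)(K+2))` — exactly diffusive in the number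
of levels, per half-sweep. [ours] -/
theorem ptHalfScan_one_sub_lagOneAutocorr_twoSided (hXm : Measurable X) (hXb : ∃ C, ∀ x, |X x| ≤ C) {a b m M : ℝ}
    (hab : a < b) (hm : ∀ u ∈ Icc a b, m ≤ variance X (μ.tilted fun x => u * X x))
    (hM : ∀ u ∈ Icc a b, variance X (μ.tilted fun x => u * X x) ≤ M) (hK : 1 ≤ K)
    (Mk : Kernel (Fin (K + 1) × (Fin (K + 1) → Ω)) (Fin (K + 1) × (Fin (K + 1) → Ω))) [IsMarkovKernel Mk]
    (hMk : ∀ y, Mk y {y' | ((y'.1 : Fin (K + 1)) : ℕ) ≠ ((y.1 : Fin (K + 1)) : ℕ)} = 0) :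
    6 * Real.exp (-((b - a) / K * Real.sqrt (2 * M) + M * ((b - a) / K) ^ 2)) / ((K + 1) * (K + 2)) ≤
      1 - (autocov (Mk ∘ₖ ptHalfSweep hXm (fun k => a + k * ((b - a) / K)) K)
          (ptTaggedTarget X μ (fun k => a + k * ((b - a) / K)) K)
          (fun z => (((z.1 : Fin (K + 1)) : ℕ) : ℝ)) 1 - ((K : ℝ) / 2) ^ 2) / (K * (K + 2) / 12) ∧
    1 - (autocov (Mk ∘ₖ ptHalfSweep hXm (fun k => a + k * ((b - a) / K)) K)
          (ptTaggedTarget X μ (fun k => a + k * ((b - a) / K)) K)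
          (fun z => (((z.1 : Fin (K + 1)) : ℕ) : ℝ)) 1 - ((K : ℝ) / 2) ^ 2) / (K * (K + 2) / 12) ≤
      6 * Real.exp (-(m * (b - a) ^ 2 / (4 * K ^ 2))) / ((K + 1) * (K + 2)) := by
  rw [ptHalfScan_level_lagOneAutocorr_eq (β := fun k => a + k * ((b - a) / K)) hXm hXb hK Mk hMk]
  have hKr : (1 : ℝ) ≤ K := by exact_mod_cast hK
  have hK0 : (0 : ℝ) < K := by linarith
  have hδ : 0 ≤ (b - a) / K := div_nonneg (sub_nonneg.2 hab.le) hK0.le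
  set S : ℝ := ∑ j : Fin K, swapAcc X μ (a + (j : ℕ) * ((b - a) / K)) (a + (((j : ℕ) + 1 : ℕ) : ℝ) * ((b - a) / K))
    with hS_def
  have hlow : (K : ℝ) * Real.exp (-((b - a) / K * Real.sqrt (2 * M) + M * ((b - a) / K) ^ 2)) ≤ S := by
    have hstep : ∀ j : Fin K, Real.exp (-((b - a) / K * Real.sqrt (2 * M) + M * ((b - a) / K) ^ 2)) ≤
        swapAcc X μ (a + (j : ℕ) * ((b - a) / K)) (a + (((j : ℕ) + 1 : ℕ) : ℝ) * ((b - a) / K)) := by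
      intro j
      have hjK : ((j : ℕ) : ℝ) + 1 ≤ K := by exact_mod_cast Nat.succ_le_of_lt j.isLt
      have hs : a ≤ a + (j : ℕ) * ((b - a) / K) := le_add_of_nonneg_right (mul_nonneg (Nat.cast_nonneg _) hδ)
      have hst : a + (j : ℕ) * ((b - a) / K) ≤ a + (((j : ℕ) + 1 : ℕ) : ℝ) * ((b - a) / K) := by
        push_cast; nlinarith
      have ht : a + (((j : ℕ) + 1 : ℕ) : ℝ) * ((b - a) / K) ≤ b := by
        push_cast
        have : (((j : ℕ) : ℝ) + 1) * ((b - a) / K) ≤ K * ((b - a) / K) := mul_le_mul_of_nonneg_right hjK hδ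
        rw [mul_div_cancel₀ _ hK0.ne'] at this
        linarith
      have h := swapAcc_ge_exp_neg_ceiling hXm hXb hst fun u hu => hM u ⟨hs.trans hu.1, hu.2.trans ht⟩
      have e : a + (((j : ℕ) + 1 : ℕ) : ℝ) * ((b - a) / K) - (a + (j : ℕ) * ((b - a) / K)) = (b - a) / K := by
        push_cast; ring
      rw [e] at h
      exact h
    calc (K : ℝ) * Real.exp (-((b - a) / K * Real.sqrt (2 * M) + M * ((b - a) / K) ^ 2))
        = ∑ _j : Fin K, Real.exp (-((b - a) / K * Real.sqrt (2 * M) + M * ((b - a) / K) ^ 2)) := by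
          rw [Finset.sum_const, Finset.card_univ, Fintype.card_fin, nsmul_eq_mul]
      _ ≤ S := Finset.sum_le_sum fun j _ => hstep j
  have hK1 : (0 : ℝ) < K + 1 := by linarith
  have hK2 : (0 : ℝ) < (K + 1) * (K + 2) := by positivity
  constructor
  · have e : 1 - (1 - 3 * (2 / (K + 1) * S) / (K * (K + 2))) = 6 * S / ((K + 1) * (K * (K + 2))) := by
      field_simp
      ring
    rw [e, div_le_div_iff₀ hK2 (by positivity)]
    have h1 : 6 * Real.exp (-((b - a) / K * Real.sqrt (2 * M) + M * ((b - a) / K) ^ 2)) * ((K + 1) * (K * (K + 2)))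
        = (6 * (K * Real.exp (-((b - a) / K * Real.sqrt (2 * M) + M * ((b - a) / K) ^ 2)))) *
          ((K + 1) * (K + 2)) := by
      ring
    rw [h1]
    exact mul_le_mul_of_nonneg_right (by linarith) hK2.le
  · have h2 := ptHalfScan_one_sub_lagOneAutocorr_le (μ := μ) hXm hXb hab.le hm hK Mk hMk
    rwa [ptHalfScan_level_lagOneAutocorr_eq (β := fun k => a + k * ((b - a) / K)) hXm hXb hK Mk hMk] at h2

end Ladder

/-! ## §5 The floor is attained with `K* = ⌈(b−a)√(2M)⌉` levels; the tag is never frozen -/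

section Optimal

variable {Ω : Type*} [MeasurableSpace Ω] {X : Ω → ℝ} {μ : Measure Ω} [IsProbabilityMeasure μ]

/-- **THE LADDER-SIZE-FREE RATE PER HALF-SWEEP IS ATTAINED WITH `K* = ⌈(b−a)√(2M)⌉` GAPS**: for the PTBC sampler
`Mk ∘ₖ H` on the uniform ladder with `K*` steps (`a < b`, `0 < M`, `Var_{μ_u}(X) ≤ M` on `[a,b]`, `Mk` any
tag-preserving Markov replica update), `6·e^{−2}/(((b−a)√(2M)+2)·((b−a)√(2M)+3)) ≤ 1 − ρ_τ(1)` — order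
`1/(M(b−a)²)` per half-sweep. [ours] -/
theorem ptHalfScan_one_sub_lagOneAutocorr_ge_optimalLadder (hXm : Measurable X) (hXb : ∃ C, ∀ x, |X x| ≤ C)
    {a b M : ℝ} (hab : a < b) (hM0 : 0 < M) (hM : ∀ u ∈ Icc a b, variance X (μ.tilted fun x => u * X x) ≤ M)
    (Mk : Kernel (Fin (⌈(b - a) * Real.sqrt (2 * M)⌉₊ + 1) × (Fin (⌈(b - a) * Real.sqrt (2 * M)⌉₊ + 1) → Ω))
      (Fin (⌈(b - a) * Real.sqrt (2 * M)⌉₊ + 1) × (Fin (⌈(b - a) * Real.sqrt (2 * M)⌉₊ + 1) → Ω)))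
    [IsMarkovKernel Mk]
    (hMk : ∀ y, Mk y {y' | ((y'.1 : Fin (⌈(b - a) * Real.sqrt (2 * M)⌉₊ + 1)) : ℕ) ≠
      ((y.1 : Fin (⌈(b - a) * Real.sqrt (2 * M)⌉₊ + 1)) : ℕ)} = 0) :
    6 * Real.exp (-2) / (((b - a) * Real.sqrt (2 * M) + 2) * ((b - a) * Real.sqrt (2 * M) + 3)) ≤
      1 - (autocov (Mk ∘ₖ ptHalfSweep hXm
              (fun k => a + k * ((b - a) / ⌈(b - a) * Real.sqrt (2 * M)⌉₊)) ⌈(b - a) * Real.sqrt (2 * M)⌉₊)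
          (ptTaggedTarget X μ (fun k => a + k * ((b - a) / ⌈(b - a) * Real.sqrt (2 * M)⌉₊))
            ⌈(b - a) * Real.sqrt (2 * M)⌉₊)
          (fun z => (((z.1 : Fin (⌈(b - a) * Real.sqrt (2 * M)⌉₊ + 1)) : ℕ) : ℝ)) 1 -
            ((⌈(b - a) * Real.sqrt (2 * M)⌉₊ : ℝ) / 2) ^ 2) /
        (⌈(b - a) * Real.sqrt (2 * M)⌉₊ * (⌈(b - a) * Real.sqrt (2 * M)⌉₊ + 2) / 12) := by
  have hM2 : 0 < 2 * M := by linarith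
  have hK1 : 1 ≤ ⌈(b - a) * Real.sqrt (2 * M)⌉₊ := natCeil_window_pos hab hM2
  have hm : ∀ u ∈ Icc a b, (0 : ℝ) ≤ variance X (μ.tilted fun x => u * X x) := fun u _ => variance_nonneg _ _
  have h := (ptHalfScan_one_sub_lagOneAutocorr_twoSided (μ := μ) hXm hXb hab hm hM hK1 Mk hMk).1
  refine le_trans ?_ h
  have hs : 0 ≤ Real.sqrt (2 * M) := Real.sqrt_nonneg _
  have hδ1 : (b - a) / ⌈(b - a) * Real.sqrt (2 * M)⌉₊ * Real.sqrt (2 * M) ≤ 1 :=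
    window_div_ceil_mul_sqrt_le_one hab hM2
  have hδ0 : 0 ≤ (b - a) / ⌈(b - a) * Real.sqrt (2 * M)⌉₊ * Real.sqrt (2 * M) :=
    mul_nonneg (div_nonneg (sub_nonneg.2 hab.le) (Nat.cast_nonneg _)) hs
  have hexp : Real.exp (-2) ≤ Real.exp (-((b - a) / ⌈(b - a) * Real.sqrt (2 * M)⌉₊ * Real.sqrt (2 * M) +
      M * ((b - a) / ⌈(b - a) * Real.sqrt (2 * M)⌉₊) ^ 2)) := by
    apply Real.exp_le_exp.2
    have e : M * ((b - a) / ⌈(b - a) * Real.sqrt (2 * M)⌉₊) ^ 2 =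
        ((b - a) / ⌈(b - a) * Real.sqrt (2 * M)⌉₊ * Real.sqrt (2 * M)) ^ 2 / 2 := by
      rw [mul_pow, Real.sq_sqrt hM2.le]; ring
    rw [e]
    nlinarith
  have hKle : ((⌈(b - a) * Real.sqrt (2 * M)⌉₊ : ℕ) : ℝ) ≤ (b - a) * Real.sqrt (2 * M) + 1 :=
    (Nat.ceil_lt_add_one (mul_nonneg (sub_nonneg.2 hab.le) hs)).le
  have hKpos : (0 : ℝ) < (((⌈(b - a) * Real.sqrt (2 * M)⌉₊ : ℕ) : ℝ) + 1) *
      (((⌈(b - a) * Real.sqrt (2 * M)⌉₊ : ℕ) : ℝ) + 2) := by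
    positivity
  have hw : 0 ≤ (b - a) * Real.sqrt (2 * M) := mul_nonneg (sub_nonneg.2 hab.le) hs
  have hden : (((⌈(b - a) * Real.sqrt (2 * M)⌉₊ : ℕ) : ℝ) + 1) * (((⌈(b - a) * Real.sqrt (2 * M)⌉₊ : ℕ) : ℝ) + 2) ≤
      ((b - a) * Real.sqrt (2 * M) + 2) * ((b - a) * Real.sqrt (2 * M) + 3) := by
    have h1 : ((⌈(b - a) * Real.sqrt (2 * M)⌉₊ : ℕ) : ℝ) + 1 ≤ (b - a) * Real.sqrt (2 * M) + 2 := by linarith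
    have h2 : ((⌈(b - a) * Real.sqrt (2 * M)⌉₊ : ℕ) : ℝ) + 2 ≤ (b - a) * Real.sqrt (2 * M) + 3 := by linarith
    have h0 : (0 : ℝ) ≤ ((⌈(b - a) * Real.sqrt (2 * M)⌉₊ : ℕ) : ℝ) := Nat.cast_nonneg _
    exact mul_le_mul h1 h2 (by linarith) (by linarith)
  calc 6 * Real.exp (-2) / (((b - a) * Real.sqrt (2 * M) + 2) * ((b - a) * Real.sqrt (2 * M) + 3))
      ≤ 6 * Real.exp (-2) / ((((⌈(b - a) * Real.sqrt (2 * M)⌉₊ : ℕ) : ℝ) + 1) *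
          (((⌈(b - a) * Real.sqrt (2 * M)⌉₊ : ℕ) : ℝ) + 2)) :=
        div_le_div_of_nonneg_left (by positivity) hKpos hden
    _ ≤ 6 * Real.exp (-((b - a) / ⌈(b - a) * Real.sqrt (2 * M)⌉₊ * Real.sqrt (2 * M) +
          M * ((b - a) / ⌈(b - a) * Real.sqrt (2 * M)⌉₊) ^ 2)) / ((((⌈(b - a) * Real.sqrt (2 * M)⌉₊ : ℕ) : ℝ) + 1) *
          (((⌈(b - a) * Real.sqrt (2 * M)⌉₊ : ℕ) : ℝ) + 2)) := by
        gcongr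

variable {β : ℕ → ℝ} {K : ℕ}

/-- **THE TAG IS NEVER FROZEN AT LAG ONE under the half-sweep sampler**: `ρ_τ(1) < 1` for `M ∘ₖ H` (`K ≥ 1`,
`M` any tag-preserving Markov replica update). [ours] -/
theorem ptHalfScan_level_lagOneAutocorr_lt_one (hXm : Measurable X) (hXb : ∃ C, ∀ x, |X x| ≤ C) (hK : 1 ≤ K)
    (M : Kernel (Fin (K + 1) × (Fin (K + 1) → Ω)) (Fin (K + 1) × (Fin (K + 1) → Ω))) [IsMarkovKernel M]
    (hM : ∀ y, M y {y' | ((y'.1 : Fin (K + 1)) : ℕ) ≠ ((y.1 : Fin (K + 1)) : ℕ)} = 0) :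
    (autocov (M ∘ₖ ptHalfSweep hXm β K) (ptTaggedTarget X μ β K) (fun z => (((z.1 : Fin (K + 1)) : ℕ) : ℝ)) 1 -
        ((K : ℝ) / 2) ^ 2) / (K * (K + 2) / 12) < 1 := by
  rw [ptHalfScan_level_lagOneAutocorr_eq hXm hXb hK M hM]
  have hK0 : (0 : ℝ) < K := by exact_mod_cast hK
  have h := pt_abar_pos (μ := μ) (β := β) hXm hXb hK
  have : 0 < 3 * (2 / (K + 1) * ∑ j : Fin K, swapAcc X μ (β (j : ℕ)) (β ((j : ℕ) + 1))) / (K * (K + 2)) := by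
    positivity
  linarith

end Optimal

end Summit.Ventures.LatticeQCDFlow.Scaling

end
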